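import Literature.MathematicalPhysics.QuantumLattice.SpinTwistedBdGModes
import Literature.MathematicalPhysics.QuantumLattice.FermionTorusPlaneWaveInversion
import Literature.MathematicalPhysics.QuantumLattice.PatchPairOperator

/-!
# Route `NodalDiracTwist` — support `TwistCalibrationBdG`: bond bilinears in momentum space

Item stmt-HubbardSuperconductivity-1625 (`TwistCalibrationBdG`) is the exact `U = 0` solution of the
d-wave-sourced spin-twisted torus `sourcedSpinTwistedHubbardTorus L 0 μ₀ h φ`
(`Literature/MathematicalPhysics/QuantumLattice/SpinTwistedHubbardTorus.lean`; vocabulary in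
`SpinTwistedBdGModes.lean`). This first helper file moves the family to momentum space:
* character sums over the fermionic torus and the Fourier transform of the bond bilinears along a
  lattice direction, `Σ_x c†_{xσ} c_{x+e_μ,τ} = Σ_k χ_k(e_μ) c†_{kσ}c_{kτ}`,
  `Σ_x c_{xσ} c_{x+e_μ,τ} = Σ_k conj χ_k(e_μ) c_{kσ}c_{-k,τ}` (and the reversed bonds; the tree's
  `PatchPairOperator.sum_annihilation_mul_annihilation_shift` is the `TorusSite`-indexed pair case);
* `spinTwistedHopping_eq_sum_momentumNumber`: `T_L(φ) = Σ_{k,σ} t_σ(k,φ) n_{kσ}`,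
  `t_σ = twistHopSymbol` (`2Σ_μ cos(p_μ + (-1)^σ φ_μ/L)`);
* `twistedDWavePairField_eq_sum`: `P_φ = Σ_k ĝ_φ(k) c_{k↑} c_{-k↓}`, `ĝ_φ = twistPairSymbol`.

Sources: Friedli–Velenik (2017) §10.4 (Fourier analysis on `(ℤ/Lℤ)^d`); Karakuzu–Seki–Sorella,
PRB 98 (2018) 075156, Sec. II D (opposite spin twists keep the pairs at zero momentum). No definitions.
-/

-- the mandated namespace `Summit.<Summit>.<Problem>.Theorems` repeats `HubbardSuperconductivity`
-- (single-problem summit, D-0017), which the `dupNamespace` linter flags on every declaration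
set_option linter.dupNamespace false

namespace Summit.HubbardSuperconductivity.HubbardSuperconductivity.Theorems.NodalDiracTwist

open Matrix Finset Literature.Probability.LatticeModels Literature.MathematicalPhysics.QuantumLattice
open scoped ComplexConjugate

variable {d L : ℕ} [NeZero L]

/-! ### Character sums over the fermionic torus -/

/-- `Σ_x (w conj χ_k(x̄)) (w χ_{k'}(x̄)) = δ_{kk'}` (`w = L^{-d/2}`). [folklore] -/
theorem sum_weight_conj_torusChar_mul_weight_torusChar (k k' : TorusSite d L) :
    ∑ x : FermionTorus d L, torusFourierWeight d L * conj (torusChar k x.toTorusSite) *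
        (torusFourierWeight d L * torusChar k' x.toTorusSite) = if k = k' then 1 else 0 := by
  rw [FermionTorus.sum_eq_sum_torusSite]
  simp only [FermionTorus.toTorusSite_ofTorusSite]
  have h := sum_torusChar_right (k' - k)
  simp only [torusChar_sub_left] at h
  calc _ = torusFourierWeight d L * torusFourierWeight d L *
        ∑ z : TorusSite d L, torusChar k' z * conj (torusChar k z) := by
        rw [Finset.mul_sum]
        exact Finset.sum_congr rfl fun z _ => by ring
    _ = _ := by
        rw [h]
        simp only [sub_eq_zero, @eq_comm _ k' k]
        split_ifs
        · exact torusFourierWeight_mul_self_mul_pow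
        · exact mul_zero _

/-- `Σ_x (w χ_k(x̄)) (w χ_{k'}(x̄)) = δ_{k', -k}`. [folklore] -/
theorem sum_weight_torusChar_mul_weight_torusChar (k k' : TorusSite d L) :
    ∑ x : FermionTorus d L, torusFourierWeight d L * torusChar k x.toTorusSite *
        (torusFourierWeight d L * torusChar k' x.toTorusSite) = if k' = -k then 1 else 0 := by
  rw [FermionTorus.sum_eq_sum_torusSite]
  simp only [FermionTorus.toTorusSite_ofTorusSite]
  have h := sum_torusChar_right (k + k')
  simp only [← torusChar_mul_torusChar_left] at h
  calc _ = torusFourierWeight d L * torusFourierWeight d L *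
        ∑ z : TorusSite d L, torusChar k z * torusChar k' z := by
        rw [Finset.mul_sum]
        exact Finset.sum_congr rfl fun z _ => by ring
    _ = _ := by
        rw [h]
        have : (k + k' = 0) ↔ (k' = -k) := by
          constructor
          · intro hk; exact eq_neg_of_add_eq_zero_right hk
          · rintro rfl; exact add_neg_cancel k
        simp only [this]
        split_ifs
        · exact torusFourierWeight_mul_self_mul_pow
        · exact mul_zero _

/-! ### Fourier transform of bond bilinears -/

/-- **Hopping bilinear along a bond direction in momentum space**:
`Σ_x c†_{xσ} c_{x+e_μ,τ} = Σ_k χ_k(e_μ) c†_{kσ} c_{kτ}`. [folklore] -/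
theorem sum_creation_orb_mul_annihilation_orb_shift (μ : Fin d) (σ τ : Fin 2) :
    ∑ x : FermionTorus d L, creation (orb x σ) * annihilation (orb (FermionTorus.shift x μ) τ) =
      ∑ k : TorusSite d L, torusChar k (Pi.single μ 1) •
        (momentumCreation k σ * momentumAnnihilation k τ) := by
  have hx : ∀ x : FermionTorus d L,
      creation (orb x σ) * annihilation (orb (FermionTorus.shift x μ) τ) =
      ∑ k : TorusSite d L, ∑ k' : TorusSite d L,
        (torusFourierWeight d L * conj (torusChar k x.toTorusSite) *
          (torusFourierWeight d L * torusChar k' x.toTorusSite) * torusChar k' (Pi.single μ 1)) •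
        (momentumCreation k σ * momentumAnnihilation k' τ) := by
    intro x
    rw [creation_orb_eq_sum_momentumCreation, annihilation_orb_eq_sum_momentumAnnihilation,
      Finset.sum_mul_sum]
    refine Finset.sum_congr rfl fun k _ => Finset.sum_congr rfl fun k' _ => ?_
    rw [smul_mul_smul_comm, FermionTorus.toTorusSite_shift, torusChar_add_right]
    congr 1
    ring
  simp_rw [hx]
  rw [Finset.sum_comm]
  refine Finset.sum_congr rfl fun k _ => ?_
  rw [Finset.sum_comm]
  simp only [← Finset.sum_smul, ← Finset.sum_mul, sum_weight_conj_torusChar_mul_weight_torusChar,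
    ite_mul, one_mul, zero_mul, ite_smul, zero_smul, Finset.sum_ite_eq, Finset.mem_univ, if_true]

/-- The reversed bond: `Σ_x c†_{x+e_μ,σ} c_{xτ} = Σ_k conj χ_k(e_μ) c†_{kσ} c_{kτ}`. [folklore] -/
theorem sum_creation_orb_shift_mul_annihilation_orb (μ : Fin d) (σ τ : Fin 2) :
    ∑ x : FermionTorus d L, creation (orb (FermionTorus.shift x μ) σ) * annihilation (orb x τ) =
      ∑ k : TorusSite d L, conj (torusChar k (Pi.single μ 1)) •
        (momentumCreation k σ * momentumAnnihilation k τ) := by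
  have h := congrArg conjTranspose (sum_creation_orb_mul_annihilation_orb_shift (L := L) μ τ σ)
  simp only [conjTranspose_sum, conjTranspose_mul, conjTranspose_smul, creation_conjTranspose,
    annihilation_conjTranspose, momentumCreation_conjTranspose,
    momentumAnnihilation_conjTranspose, Complex.star_def] at h
  exact h

/-- **Pair bilinear along a bond direction in momentum space**:
`Σ_x c_{xσ} c_{x+e_μ,τ} = Σ_k conj χ_k(e_μ) c_{kσ} c_{-k,τ}`. [folklore] -/
theorem sum_annihilation_orb_mul_annihilation_orb_shift (μ : Fin d) (σ τ : Fin 2) :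
    ∑ x : FermionTorus d L, annihilation (orb x σ) * annihilation (orb (FermionTorus.shift x μ) τ) =
      ∑ k : TorusSite d L, conj (torusChar k (Pi.single μ 1)) •
        (momentumAnnihilation k σ * momentumAnnihilation (-k) τ) := by
  have hx : ∀ x : FermionTorus d L,
      annihilation (orb x σ) * annihilation (orb (FermionTorus.shift x μ) τ) =
      ∑ k : TorusSite d L, ∑ k' : TorusSite d L,
        (torusFourierWeight d L * torusChar k x.toTorusSite *
          (torusFourierWeight d L * torusChar k' x.toTorusSite) * torusChar k' (Pi.single μ 1)) •
        (momentumAnnihilation k σ * momentumAnnihilation k' τ) := by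
    intro x
    rw [annihilation_orb_eq_sum_momentumAnnihilation, annihilation_orb_eq_sum_momentumAnnihilation,
      Finset.sum_mul_sum]
    refine Finset.sum_congr rfl fun k _ => Finset.sum_congr rfl fun k' _ => ?_
    rw [smul_mul_smul_comm, FermionTorus.toTorusSite_shift, torusChar_add_right]
    congr 1
    ring
  simp_rw [hx]
  rw [Finset.sum_comm]
  refine Finset.sum_congr rfl fun k _ => ?_
  rw [Finset.sum_comm]
  simp only [← Finset.sum_smul, ← Finset.sum_mul, sum_weight_torusChar_mul_weight_torusChar,
    ite_mul, one_mul, zero_mul, ite_smul, zero_smul, Finset.sum_ite_eq', Finset.mem_univ, if_true,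
    torusChar_neg_left]

/-- The reversed bond: `Σ_x c_{x+e_μ,σ} c_{xτ} = Σ_k χ_k(e_μ) c_{kσ} c_{-k,τ}`. [folklore] -/
theorem sum_annihilation_orb_shift_mul_annihilation_orb (μ : Fin d) (σ τ : Fin 2) :
    ∑ x : FermionTorus d L, annihilation (orb (FermionTorus.shift x μ) σ) * annihilation (orb x τ) =
      ∑ k : TorusSite d L, torusChar k (Pi.single μ 1) •
        (momentumAnnihilation k σ * momentumAnnihilation (-k) τ) := by
  have h1 : ∀ x : FermionTorus d L,
      annihilation (orb (FermionTorus.shift x μ) σ) * annihilation (orb x τ) =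
        -(annihilation (orb x τ) * annihilation (orb (FermionTorus.shift x μ) σ)) := fun x =>
    eq_neg_of_add_eq_zero_left (annihilation_anticommute_holds _ _)
  simp_rw [h1]
  rw [Finset.sum_neg_distrib, sum_annihilation_orb_mul_annihilation_orb_shift]
  rw [← Equiv.sum_comp (Equiv.neg (TorusSite d L))]
  rw [← Finset.sum_neg_distrib]
  refine Finset.sum_congr rfl fun k _ => ?_
  simp only [Equiv.neg_apply, neg_neg, torusChar_neg_left, Complex.conj_conj,
    momentumAnnihilation_mul_eq_neg (-k) k τ σ, smul_neg, neg_neg]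


/-! ### The twisted symbols -/

/-- `e^{iθ} χ_k(e_μ) + e^{-iθ} conj χ_k(e_μ) = 2 cos(p_μ + θ)`, `p = 2πk/L`. [folklore] -/
theorem exp_mul_torusChar_single_add_conj (k : TorusSite d L) (μ : Fin d) (θ : ℝ) :
    Complex.exp (Complex.I * (θ : ℂ)) * torusChar k (Pi.single μ 1) +
      Complex.exp (-(Complex.I * (θ : ℂ))) * conj (torusChar k (Pi.single μ 1)) =
    ((2 * Real.cos (latticeMomentum L k μ + θ) : ℝ) : ℂ) := by
  have hχ : torusChar k (Pi.single μ 1) = Complex.exp ((latticeMomentum L k μ : ℝ) * Complex.I) := by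
    rw [torusChar_single_eq_exp, latticeMomentum]
    congr 1
    push_cast
    ring
  rw [hχ, ← Complex.exp_conj, ← Complex.exp_add, ← Complex.exp_add, map_mul, Complex.conj_ofReal,
    Complex.conj_I, Complex.ofReal_mul, Complex.ofReal_ofNat, Complex.ofReal_cos, Complex.two_cos]
  congr 1
  · congr 1; push_cast; ring
  · congr 1; push_cast; ring

/-- **The twisted hopping in momentum space**: `T_L(φ) = Σ_{k,σ} t_σ(k,φ) n_{kσ}`. [folklore] -/
theorem spinTwistedHopping_eq_sum_momentumNumber (φ : Fin 2 → ℝ) :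
    spinTwistedHopping L φ = ∑ k : TorusSite 2 L, ∑ σ : Fin 2,
      ((twistHopSymbol L φ k σ : ℝ) : ℂ) • momentumNumber k σ := by
  have hin : ∀ (σ μ : Fin 2), ∑ x : FermionTorus 2 L,
      (Complex.exp (Complex.I * (((-1 : ℝ) ^ (σ : ℕ) * φ μ / L : ℝ) : ℂ)) •
          (creation (orb x σ) * annihilation (orb (FermionTorus.shift x μ) σ)) +
        Complex.exp (-(Complex.I * (((-1 : ℝ) ^ (σ : ℕ) * φ μ / L : ℝ) : ℂ))) •
          (creation (orb (FermionTorus.shift x μ) σ) * annihilation (orb x σ))) =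
      ∑ k : TorusSite 2 L, ((2 * Real.cos (latticeMomentum L k μ +
        (-1 : ℝ) ^ (σ : ℕ) * φ μ / L) : ℝ) : ℂ) • momentumNumber k σ := by
    intro σ μ
    rw [Finset.sum_add_distrib, ← Finset.smul_sum, ← Finset.smul_sum,
      sum_creation_orb_mul_annihilation_orb_shift, sum_creation_orb_shift_mul_annihilation_orb, Finset.smul_sum,
      Finset.smul_sum, ← Finset.sum_add_distrib]
    refine Finset.sum_congr rfl fun k _ => ?_
    rw [smul_smul, smul_smul, ← add_smul, exp_mul_torusChar_single_add_conj]
    rfl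
  calc spinTwistedHopping L φ
      = ∑ μ : Fin 2, ∑ σ : Fin 2, ∑ x : FermionTorus 2 L,
          (Complex.exp (Complex.I * (((-1 : ℝ) ^ (σ : ℕ) * φ μ / L : ℝ) : ℂ)) •
            (creation (orb x σ) * annihilation (orb (FermionTorus.shift x μ) σ)) +
          Complex.exp (-(Complex.I * (((-1 : ℝ) ^ (σ : ℕ) * φ μ / L : ℝ) : ℂ))) •
            (creation (orb (FermionTorus.shift x μ) σ) * annihilation (orb x σ))) := by
        unfold spinTwistedHopping
        rw [Finset.sum_comm]
        exact Finset.sum_congr rfl fun μ _ => Finset.sum_comm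
    _ = ∑ μ : Fin 2, ∑ σ : Fin 2, ∑ k : TorusSite 2 L, ((2 * Real.cos (latticeMomentum L k μ +
          (-1 : ℝ) ^ (σ : ℕ) * φ μ / L) : ℝ) : ℂ) • momentumNumber k σ := by
        simp_rw [hin]
    _ = ∑ σ : Fin 2, ∑ k : TorusSite 2 L, ∑ μ : Fin 2, ((2 * Real.cos (latticeMomentum L k μ +
          (-1 : ℝ) ^ (σ : ℕ) * φ μ / L) : ℝ) : ℂ) • momentumNumber k σ := by
        rw [Finset.sum_comm]
        exact Finset.sum_congr rfl fun σ _ => Finset.sum_comm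
    _ = _ := by
        rw [Finset.sum_comm]
        refine Finset.sum_congr rfl fun k _ => Finset.sum_congr rfl fun σ _ => ?_
        rw [← Finset.sum_smul, twistHopSymbol, Finset.mul_sum, Complex.ofReal_sum]

/-- **The twisted `d`-wave pair field in momentum space**: `P_φ = Σ_k ĝ_φ(k) c_{k↑} c_{-k↓}` (pairs at
zero total momentum). [folklore] -/
theorem twistedDWavePairField_eq_sum (φ : Fin 2 → ℝ) :
    twistedDWavePairField L φ = ∑ k : TorusSite 2 L,
      ((twistPairSymbol L φ k : ℝ) : ℂ) • (momentumAnnihilation k 0 * momentumAnnihilation (-k) 1) := by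
  have hin : ∀ μ : Fin 2, ∑ x : FermionTorus 2 L, ((-1 : ℂ) ^ (μ : ℕ)) •
      (Complex.exp (-(Complex.I * ((φ μ / L : ℝ) : ℂ))) •
          (annihilation (orb x 0) * annihilation (orb (FermionTorus.shift x μ) 1)) +
        Complex.exp (Complex.I * ((φ μ / L : ℝ) : ℂ)) •
          (annihilation (orb (FermionTorus.shift x μ) 0) * annihilation (orb x 1))) =
      ∑ k : TorusSite 2 L, (((-1 : ℝ) ^ (μ : ℕ) * (2 * Real.cos (latticeMomentum L k μ + φ μ / L))
        : ℝ) : ℂ) • (momentumAnnihilation k 0 * momentumAnnihilation (-k) 1) := by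
    intro μ
    rw [← Finset.smul_sum, Finset.sum_add_distrib, ← Finset.smul_sum, ← Finset.smul_sum,
      sum_annihilation_orb_mul_annihilation_orb_shift, sum_annihilation_orb_shift_mul_annihilation_orb,
      Finset.smul_sum, Finset.smul_sum, ← Finset.sum_add_distrib, Finset.smul_sum]
    refine Finset.sum_congr rfl fun k _ => ?_
    rw [smul_smul, smul_smul, ← add_smul, smul_smul, add_comm,
      exp_mul_torusChar_single_add_conj]
    push_cast
    rfl
  calc twistedDWavePairField L φ
      = ∑ μ : Fin 2, ∑ x : FermionTorus 2 L, ((-1 : ℂ) ^ (μ : ℕ)) •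
          (Complex.exp (-(Complex.I * ((φ μ / L : ℝ) : ℂ))) •
            (annihilation (orb x 0) * annihilation (orb (FermionTorus.shift x μ) 1)) +
          Complex.exp (Complex.I * ((φ μ / L : ℝ) : ℂ)) •
            (annihilation (orb (FermionTorus.shift x μ) 0) * annihilation (orb x 1))) := by
        unfold twistedDWavePairField
        exact Finset.sum_comm
    _ = ∑ μ : Fin 2, ∑ k : TorusSite 2 L, (((-1 : ℝ) ^ (μ : ℕ) *
          (2 * Real.cos (latticeMomentum L k μ + φ μ / L)) : ℝ) : ℂ) •
          (momentumAnnihilation k 0 * momentumAnnihilation (-k) 1) := by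
        simp_rw [hin]
    _ = _ := by
        rw [Finset.sum_comm]
        refine Finset.sum_congr rfl fun k _ => ?_
        rw [← Finset.sum_smul, twistPairSymbol, Finset.mul_sum, Complex.ofReal_sum]
        congr 1
        refine Finset.sum_congr rfl fun μ _ => ?_
        push_cast
        ring

end Summit.HubbardSuperconductivity.HubbardSuperconductivity.Theorems.NodalDiracTwist
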